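import Literature.NumberTheory.Weil1964.AdelicMetaplecticFiniteImplementer
import Literature.NumberTheory.Weil1964.ArchFollandCoordinates
import Literature.Analysis.SegalBargmann.SchwartzHeisenbergSchur
import HarnessLib

/-!
# The finite factor `ω_f` of `ω = ω_∞ ⊗ ω_f` on `Mp_ψ(W_𝔸)`, read off from the adelic operators

Origin: `pub-hodgecm` MODEL-CONSTRUCTION sub-cell, construction prover `mc-theta-2` (gen 5), node W6a (W-Kf′) of
`MODEL-DAG.md` (the FINITE mirror of `AdelicMetaplecticArchRep`). KERNEL MATHEMATICS ONLY: definitions + theorems over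
tree declarations; no `def … : Prop` record, no `axiom`, no proof hole. A REPRODUCTION of a published construction
(Literature side).

THE CONSTRUCTION. `𝒮(𝔸_F^ι) = 𝓢((F ⊗ ℝ)^ι) ⊗ 𝒮((𝔸_F^∞)^ι)` (`piSchwartzBruhatEquiv`). For a linear endomorphism `M`
of `𝒮(𝔸_F^ι)` put `finPart M := N_{φ₀,0}(M) : f ↦ (M(φ₀ ⊗ f))(0, ·)` (`finCoeff` of `AdelicMetaplecticFiniteImplementer`
at a fixed test function `φ₀` with `φ₀(0) = 1`), so that `finPart (1 ⊗ B) = B` (`finPart_adelicTensorEnd_id`).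

* §1 `finPart`, `finPart (1 ⊗ B) = B`, `finPart 1 = 1`; the coset indicator `𝟙_{x₀ + 𝔫𝒪̂^ι}` as a finite test vector
  and `Φ_∞ ⊗ 𝟙_{x₀ + 𝔫𝒪̂^ι} = thinCosetTestFunₗ x₀ 𝔫 Φ_∞`.
* §2 (generic) for a representation `ρ` of a monoid `G` on `𝒮(𝔸_F^ι)` by operators of the form `1 ⊗ B_g`:
  **`finRep ρ hρ : Representation ℂ G 𝒮((𝔸_F^∞)^ι)`**, `g ↦ finPart (ρ g)` — a genuine HOMOMORPHISM (`1 ⊗ ·` is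
  injective and multiplicative) with `ρ g = 1 ⊗ finRep g` (`eq_adelicTensorEnd_id_finRep`), `ρ g (Φ ⊗ f) = Φ ⊗ finRep g f`,
  uniqueness, and the TEST-FUNCTION CRITERION `finRep g 𝟙_{x₀+𝔫𝒪̂} = 𝟙_{x₀+𝔫𝒪̂} → ρ g (Φ_∞ ⊗ 𝟙_{x₀+𝔫𝒪̂}) = Φ_∞ ⊗ 𝟙_{x₀+𝔫𝒪̂}`
  for EVERY `Φ_∞` (the shape of (W-Kf′)).
* §3 at `Mp_ψ(W_𝔸)ᶜᵒⁿᵗ` (`adelicMpCont F ι T`, `T` invertible): if `π(p)` FIXES THE ARCHIMEDEAN VECTORS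
  `(archVec a, archVec w)`, then `ω(p) = 1 ⊗ B` for a (unique) `B` (`exists_omega_eq_adelicTensorEnd_id_left`). Proof:
  `ω(p) = A ⊗ M_f` with `A` a topological automorphism (`exists_finImplementer` + the topological tensor stripping
  `exists_continuousLinearEquiv_of_mem_adelicMpCont`); `A` is projectively covariant over Folland's `ρ_D(p, q)` for all
  `(p, q)` (`arch_covariant_rhoSD_all`) with TRIVIAL phase-space map and cocycle `1` because `π(p)` fixes the archimedean
  vectors (Weil's character `f_g(V) = ½(B(gV,gV) − B(V,V)) = 0`); so `A` commutes with every `ρ_D(p, q)` and is a scalar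
  by Schur's lemma on `𝓢` (`SegalBargmann.eq_smul_of_commute_rhoSD`); absorb the scalar into `M_f`. Hence for a
  homomorphism `s : H →* Mp_ψ(W_𝔸)ᶜᵒⁿᵗ` whose symplectic components fix the archimedean vectors (the finite level
  groups `K_f`, `(1_∞, k_f)`): **`finRepMp s : Representation ℂ H 𝒮((𝔸_F^∞)^ι)`** with `ω(s h) = 1 ⊗ finRepMp s h` and
  `ω(s h)(Φ_∞ ⊗ 𝟙_{x₀+𝔫𝒪̂}) = Φ_∞ ⊗ finRepMp s h 𝟙_{x₀+𝔫𝒪̂}`.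

USE (pub-hodgecm). PKG `HodgeCM/Model/ArchKType.lean`, field (W-Kf′)
`fixN : ∀ m Φ_∞, ω (κ₂ m, 1) (φ_N(Φ_∞)) = φ_N(Φ_∞)`: with `φ_N(Φ_∞) = thinCosetTestFunₗ x₀ (N) Φ_∞` it follows for ALL
`Φ_∞` from the single finite statement `finRepMp s m 𝟙_{x₀+N𝒪̂} = 𝟙_{x₀+N𝒪̂}` (`omega_thinCosetTestFunₗ_eq_self`) — a
property of the finite Weil representation alone.

## References

* [Weil1964] A. Weil, *Sur certains groupes d'opérateurs unitaires*, Acta Math. 111 (1964), Chap. I n° 5 pp. 150–151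
  (the section `σ ↦ (σ, f_σ)`), Chap. III n° 37–38 pp. 188–190 (`𝐫_𝐀 = ⊗_v 𝐫_v`; local factors of the standard
  metaplectic operators).
* [MoeglinVignerasWaldspurger1987] C. Mœglin, M.-F. Vignéras, J.-L. Waldspurger, *Correspondances de Howe sur un corps
  p-adique*, LNM 1291 (1987), Chap. 2 II.1 (A) (pairs `(g, M)`), II.2 (irreducibility / Schur for `ρ_ψ`).
* [GelbartRogawski1991] S. Gelbart, J. Rogawski, *L-functions and Fourier–Jacobi coefficients for the unitary group
  U(3)*, Invent. Math. 105 (1991), §3.1 p. 454 (`ω_ψ(g, M_g) = M_g`).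
* [Folland1989] G. B. Folland, *Harmonic Analysis in Phase Space*, Princeton UP (1989), Prop. (1.43), Thm. (1.50).

## Provenance

LEAN-IN-TREE rule (2026-08-18), pub-hodgecm model-construction sub-cell, seat mc-theta-2 gen 5; node W6a (W-Kf′).
-/

set_option autoImplicit false

noncomputable section

open scoped Matrix SchwartzMap TensorProduct Classical
open NumberField NumberField.mixedEmbedding IsDedekindDomain

namespace Literature.NumberTheory.Weil1964

open Literature.NumberTheory.Automorphic Literature.RepresentationTheory.HeisenbergGroup
open Literature.Analysis.SegalBargmann

/-! ### § 1. The finite part of an operator of the form `1 ⊗ B` -/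

section FinPart

variable {F : Type} [Field F] [NumberField F] {ι : Type} [Fintype ι]

variable (F ι) in
/-- A fixed archimedean test function `φ₀ ∈ 𝓢((F ⊗ ℝ)^ι)` with `φ₀(0) = 1` (a choice; any would do). [folklore] -/
def unitSchwartz : 𝓢((ι → mixedSpace F), ℂ) :=
  Classical.choose (exists_schwartzMap_apply_zero_eq_one (F := F) ι)

/-- `φ₀(0) = 1`. [folklore] -/
theorem unitSchwartz_apply_zero : unitSchwartz F ι 0 = 1 :=
  Classical.choose_spec (exists_schwartzMap_apply_zero_eq_one (F := F) ι)

variable (F ι) in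
/-- **The finite part** `finPart M := N_{φ₀,0}(M) : f ↦ (M(φ₀ ⊗ f))(0, ·)` of a linear endomorphism `M` of
`𝒮(𝔸_F^ι)` — a linear endomorphism of `𝒮((𝔸_F^∞)^ι)`. [cite: Weil1964, Chap. III n° 37–38 p. 188–190] -/
def finPart (M : ↥(piSchwartzBruhat F ι) →ₗ[ℂ] ↥(piSchwartzBruhat F ι)) : FinSB F ι →ₗ[ℂ] FinSB F ι :=
  finCoeff M (unitSchwartz F ι) 0

/-- Unfolding of `finPart`. [folklore] -/
theorem finPart_apply (M : ↥(piSchwartzBruhat F ι) →ₗ[ℂ] ↥(piSchwartzBruhat F ι)) (f : FinSB F ι) :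
    finPart F ι M f = finSliceLM F ι 0 (M (piSchwartzBruhatEquiv F ι (unitSchwartz F ι ⊗ₜ f))) := rfl

/-- **`finPart (1 ⊗ B) = B`.** [folklore] -/
@[simp] theorem finPart_adelicTensorEnd_id (B : FinSB F ι →ₗ[ℂ] FinSB F ι) :
    finPart F ι (adelicTensorEnd LinearMap.id B) = B := by
  refine LinearMap.ext fun f => ?_
  rw [finPart_apply, adelicTensorEnd_apply_tmul, LinearMap.id_apply, finSliceLM_tmul, unitSchwartz_apply_zero,
    one_smul]

/-- `finPart 1 = 1`. [folklore] -/
theorem finPart_one : finPart F ι 1 = 1 := by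
  rw [← adelicTensorEnd_one]
  exact finPart_adelicTensorEnd_id 1

/-- An operator commuting-wise of the form `1 ⊗ B` IS `1 ⊗ finPart M`. [folklore] -/
theorem exists_eq_adelicTensorEnd_id_left_iff (M : ↥(piSchwartzBruhat F ι) →ₗ[ℂ] ↥(piSchwartzBruhat F ι)) :
    (∃ B : FinSB F ι →ₗ[ℂ] FinSB F ι, M = adelicTensorEnd LinearMap.id B) ↔
      M = adelicTensorEnd LinearMap.id (finPart F ι M) := by
  constructor
  · rintro ⟨B, rfl⟩
    rw [finPart_adelicTensorEnd_id]
  · exact fun h => ⟨_, h⟩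

variable (F ι) in
/-- **The coset indicator** `𝟙_{x₀ + 𝔫𝒪̂^ι} ∈ 𝒮((𝔸_F^∞)^ι)` as a finite test vector. [folklore] -/
def cosetIndicatorSB (x₀ : ι → FiniteAdeleRing (𝓞 F) F) (𝔫 : Ideal (𝓞 F)) : FinSB F ι :=
  finTranslateSB F ι (-x₀)
    (indicatorSB F ι (piLevelIdeal F ι 𝔫) (isOpen_piLevelIdeal F 𝔫) (isCompact_piLevelIdeal F ι 𝔫))

/-- `Φ_∞ ⊗ 𝟙_{x₀ + 𝔫𝒪̂^ι} = thinCosetTestFunₗ x₀ 𝔫 Φ_∞`. [folklore] -/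
theorem thinCosetTestFunₗ_eq_tmul_cosetIndicatorSB (x₀ : ι → FiniteAdeleRing (𝓞 F) F) (𝔫 : Ideal (𝓞 F))
    (Φ : 𝓢((ι → mixedSpace F), ℂ)) :
    thinCosetTestFunₗ (K := F) (ι := ι) x₀ 𝔫 Φ = piSchwartzBruhatEquiv F ι (Φ ⊗ₜ cosetIndicatorSB F ι x₀ 𝔫) :=
  thinCosetTestFunₗ_eq_tmul x₀ 𝔫 Φ

end FinPart

/-! ### § 2. The finite factor of a representation by operators `1 ⊗ B_g` -/

section FinRep

variable {F : Type} [Field F] [NumberField F] {ι : Type} [Fintype ι] {G : Type*} [Monoid G]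

variable (ρ : Representation ℂ G ↥(piSchwartzBruhat F ι))
  (hρ : ∀ g, ∃ B : FinSB F ι →ₗ[ℂ] FinSB F ι, ρ g = adelicTensorEnd LinearMap.id B)

/-- **The finite factor** of a representation `ρ` of `G` on `𝒮(𝔸_F^ι)` by operators `1 ⊗ B_g`: `g ↦ finPart (ρ g)`,
a representation of `G` on `𝒮((𝔸_F^∞)^ι)`. [cite: Weil1964, Chap. III n° 37–38 p. 188–190] -/
def finRep : Representation ℂ G (FinSB F ι) where
  toFun g := finPart F ι (ρ g)
  map_one' := by
    show finPart F ι (ρ 1) = 1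
    rw [map_one]
    exact finPart_one
  map_mul' g g' := by
    show finPart F ι (ρ (g * g')) = finPart F ι (ρ g) * finPart F ι (ρ g')
    obtain ⟨B, hB⟩ := hρ g
    obtain ⟨B', hB'⟩ := hρ g'
    have hid : (LinearMap.id : 𝓢((ι → mixedSpace F), ℂ) →ₗ[ℂ] 𝓢((ι → mixedSpace F), ℂ)) * LinearMap.id =
        LinearMap.id := LinearMap.ext fun _ => rfl
    rw [map_mul, hB, hB', ← adelicTensorEnd_mul, hid]
    simp only [finPart_adelicTensorEnd_id]

/-- Unfolding: `finRep ρ hρ g = finPart (ρ g)`. [folklore] -/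
@[simp] theorem finRep_apply (g : G) : finRep ρ hρ g = finPart F ι (ρ g) := rfl

/-- **`ρ g = 1 ⊗ finRep g`.** [cite: Weil1964, Chap. III n° 37–38 p. 188–190] -/
theorem eq_adelicTensorEnd_id_finRep (g : G) : ρ g = adelicTensorEnd LinearMap.id (finRep ρ hρ g) := by
  rw [finRep_apply]
  exact (exists_eq_adelicTensorEnd_id_left_iff (ρ g)).1 (hρ g)

/-- On pure tensors: `ρ g (Φ ⊗ f) = Φ ⊗ finRep g f`. [folklore] -/
theorem finRep_map_tmul (g : G) (Φ : 𝓢((ι → mixedSpace F), ℂ)) (f : FinSB F ι) :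
    ρ g (piSchwartzBruhatEquiv F ι (Φ ⊗ₜ f)) = piSchwartzBruhatEquiv F ι (Φ ⊗ₜ finRep ρ hρ g f) := by
  have h := LinearMap.congr_fun (eq_adelicTensorEnd_id_finRep ρ hρ g) (piSchwartzBruhatEquiv F ι (Φ ⊗ₜ f))
  rw [adelicTensorEnd_apply_tmul, LinearMap.id_apply] at h
  exact h

/-- **The test-function identity**: `ρ g (Φ_∞ ⊗ 𝟙_{x₀+𝔫𝒪̂}) = Φ_∞ ⊗ (finRep g 𝟙_{x₀+𝔫𝒪̂})`. [folklore] -/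
theorem finRep_thinCosetTestFunₗ (g : G) (x₀ : ι → FiniteAdeleRing (𝓞 F) F) (𝔫 : Ideal (𝓞 F))
    (Φ : 𝓢((ι → mixedSpace F), ℂ)) :
    ρ g (thinCosetTestFunₗ (K := F) (ι := ι) x₀ 𝔫 Φ) =
      piSchwartzBruhatEquiv F ι (Φ ⊗ₜ finRep ρ hρ g (cosetIndicatorSB F ι x₀ 𝔫)) := by
  rw [thinCosetTestFunₗ_eq_tmul_cosetIndicatorSB, finRep_map_tmul]

/-- **(W-Kf′) criterion**: if `finRep g` fixes `𝟙_{x₀+𝔫𝒪̂}` then `ρ g` fixes `Φ_∞ ⊗ 𝟙_{x₀+𝔫𝒪̂}` for EVERY `Φ_∞`.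
[folklore] -/
theorem thinCosetTestFunₗ_eq_self_of_finRep (g : G) (x₀ : ι → FiniteAdeleRing (𝓞 F) F) (𝔫 : Ideal (𝓞 F))
    (hfix : finRep ρ hρ g (cosetIndicatorSB F ι x₀ 𝔫) = cosetIndicatorSB F ι x₀ 𝔫)
    (Φ : 𝓢((ι → mixedSpace F), ℂ)) :
    ρ g (thinCosetTestFunₗ (K := F) (ι := ι) x₀ 𝔫 Φ) = thinCosetTestFunₗ (K := F) (ι := ι) x₀ 𝔫 Φ := by
  rw [finRep_thinCosetTestFunₗ ρ hρ, hfix, thinCosetTestFunₗ_eq_tmul_cosetIndicatorSB]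

/-- **Uniqueness**: an operator `B` with `ρ g (Φ₀ ⊗ f) = Φ₀ ⊗ B f` for all `f` and ONE `Φ₀ ≠ 0` is `finRep g`.
[folklore] -/
theorem finRep_unique (g : G) {Φ₀ : 𝓢((ι → mixedSpace F), ℂ)} (hΦ₀ : Φ₀ ≠ 0) {B : FinSB F ι →ₗ[ℂ] FinSB F ι}
    (hB : ∀ f : FinSB F ι, ρ g (piSchwartzBruhatEquiv F ι (Φ₀ ⊗ₜ f)) = piSchwartzBruhatEquiv F ι (Φ₀ ⊗ₜ B f)) :
    B = finRep ρ hρ g := by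
  refine LinearMap.ext fun f => ?_
  have h := hB f
  rw [finRep_map_tmul] at h
  have h' := congrArg (TensorProduct.comm ℂ 𝓢((ι → mixedSpace F), ℂ) (FinSB F ι))
    ((piSchwartzBruhatEquiv F ι).injective h)
  simp only [TensorProduct.comm_tmul] at h'
  exact (tmul_left_cancel hΦ₀ h').symm

end FinRep

/-! ### § 3. At `Mp_ψ(W_𝔸)ᶜᵒⁿᵗ`: pairs fixing the archimedean vectors act by `1 ⊗ B` -/

section Mp

variable {F : Type} [Field F] [NumberField F] {ι : Type} [Fintype ι] [DecidableEq ι]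
  {T : Matrix ι ι (AdeleRing (𝓞 F) F)}

variable (F ι) in
/-- Real coordinates on `(F ⊗ ℝ)^ι` (a choice of basis; any would do). [folklore] -/
def mixedSpaceCoord : (ι → mixedSpace F) ≃L[ℝ] (Fin (Module.finrank ℝ (ι → mixedSpace F)) → ℝ) :=
  (Module.finBasis ℝ (ι → mixedSpace F)).equivFun.toContinuousLinearEquiv

/-- If `g ∈ Sp(W_𝔸)` fixes the archimedean vectors then its archimedean phase-space action is trivial. [folklore] -/
theorem archAct_eq_self_of_apply_archVec (g : symplecticGroup (polar (adelicForm F ι T)))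
    (hg : ∀ a w : ι → mixedSpace F, g.1 (archVec F ι a, archVec F ι w) = (archVec F ι a, archVec F ι w))
    (aw : (ι → mixedSpace F) × (ι → mixedSpace F)) : archAct T g aw = aw := by
  obtain ⟨a, w⟩ := aw
  simp only [archAct, hg, piArch_archVec]

/-- If `g ∈ Sp(W_𝔸)` fixes the archimedean vectors then Weil's phase `ψ_F(f_g(V))` at archimedean `V` is `1`
(`f_g(V) = ½ (B(gV, gV) − B(V, V)) = 0`). [cite: Weil1964, Chap. I n° 5 p. 150–151] -/
theorem weilPhase_eq_one_of_apply_archVec (g : symplecticGroup (polar (adelicForm F ι T)))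
    (hg : ∀ a w : ι → mixedSpace F, g.1 (archVec F ι a, archVec F ι w) = (archVec F ι a, archVec F ι w))
    (aw : (ι → mixedSpace F) × (ι → mixedSpace F)) : weilPhase T g aw = 1 := by
  obtain ⟨a, w⟩ := aw
  have hf : (ofSymplectic (polar (adelicForm F ι T)) g).f (archVec F ι a, archVec F ι w) = 0 := by
    show ⅟(2 : AdeleRing (𝓞 F) F) * _ = 0
    rw [hg a w, sub_self, mul_zero]
  simp only [weilPhase, hf, AddChar.map_zero_eq_one, Circle.coe_one]

/-- … hence the Folland cocycle is `1`. [folklore] -/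
theorem follandCocycle_eq_one_of_apply_archVec {σ : Type*} [Fintype σ] (e : (ι → mixedSpace F) ≃L[ℝ] (σ → ℝ))
    (g : symplecticGroup (polar (adelicForm F ι T)))
    (hg : ∀ a w : ι → mixedSpace F, g.1 (archVec F ι a, archVec F ι w) = (archVec F ι a, archVec F ι w))
    (aw : (ι → mixedSpace F) × (ι → mixedSpace F)) : follandCocycle T e g aw = 1 := by
  rw [follandCocycle, weilPhase_eq_one_of_apply_archVec g hg, archAct_eq_self_of_apply_archVec g hg, one_mul,
    Complex.exp_neg, inv_mul_cancel₀ (Complex.exp_ne_zero _)]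

/-- … hence, in Folland coordinates, the cocycle is `1` … [folklore] -/
theorem archCocycle_eq_one_of_apply_archVec {σ : Type*} [Fintype σ] (e : (ι → mixedSpace F) ≃L[ℝ] (σ → ℝ))
    (hT : IsUnit (archMat F ι T)) (g : symplecticGroup (polar (adelicForm F ι T)))
    (hg : ∀ a w : ι → mixedSpace F, g.1 (archVec F ι a, archVec F ι w) = (archVec F ι a, archVec F ι w))
    (pq : (σ → ℝ) × (σ → ℝ)) : archCocycle T e hT g pq = 1 := by
  rw [archCocycle]
  exact follandCocycle_eq_one_of_apply_archVec e g hg _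

/-- … and the phase-space map is the identity. [folklore] -/
theorem archPhaseMap_eq_self_of_apply_archVec {σ : Type*} [Fintype σ] (e : (ι → mixedSpace F) ≃L[ℝ] (σ → ℝ))
    (hT : IsUnit (archMat F ι T)) (g : symplecticGroup (polar (adelicForm F ι T)))
    (hg : ∀ a w : ι → mixedSpace F, g.1 (archVec F ι a, archVec F ι w) = (archVec F ι a, archVec F ι w))
    (pq : (σ → ℝ) × (σ → ℝ)) : archPhaseMap T e hT g pq = pq := by
  rw [archPhaseMap, archAct_eq_self_of_apply_archVec g hg, archFolland_archFollandInv]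

/-- **The archimedean factor of an implementer of `g` commutes with Folland's `ρ_D`** when `g` fixes the archimedean
vectors: if `M` implements `g` and `M (Φ ⊗ f) = A Φ ⊗ M_f f` then `A ρ_D(p, q) = ρ_D(p, q) A` for all `(p, q)`.
[cite: Folland1989, Prop. (1.43); Weil1964, Chap. I n° 5 p. 150–151] -/
theorem comm_rhoSD_of_apply_archVec {σ : Type*} [Fintype σ] (e : (ι → mixedSpace F) ≃L[ℝ] (σ → ℝ))
    (hT : IsUnit (archMat F ι T)) (g : symplecticGroup (polar (adelicForm F ι T)))
    (hg : ∀ a w : ι → mixedSpace F, g.1 (archVec F ι a, archVec F ι w) = (archVec F ι a, archVec F ι w))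
    (M : piSchwartzBruhat F ι ≃ₗ[ℂ] piSchwartzBruhat F ι)
    (hM : Implements (adelicSchrodinger F ι T) (ofSymplectic (polar (adelicForm F ι T)) g) M)
    (A : 𝓢((ι → mixedSpace F), ℂ) →ₗ[ℂ] 𝓢((ι → mixedSpace F), ℂ)) (Mf : FinSB F ι →ₗ[ℂ] FinSB F ι)
    (hAM : ∀ (Φ : 𝓢((ι → mixedSpace F), ℂ)) (f : FinSB F ι),
      M (piSchwartzBruhatEquiv F ι (Φ ⊗ₜ f)) = piSchwartzBruhatEquiv F ι (A Φ ⊗ₜ Mf f))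
    {f₀ : FinSB F ι} (hf₀ : Mf f₀ ≠ 0) (p q : σ → ℝ) (Φ : 𝓢((ι → mixedSpace F), ℂ)) :
    A (rhoSD e p q Φ) = rhoSD e p q (A Φ) := by
  have h := arch_covariant_rhoSD_all T e hT g M hM A Mf hAM hf₀ p q Φ
  rw [archCocycle_eq_one_of_apply_archVec e hT g hg, archPhaseMap_eq_self_of_apply_archVec e hT g hg,
    one_smul] at h
  exact h

/-- `exists_omega_eq_adelicTensorEnd_id_left` with the real coordinates `e` on `(F ⊗ ℝ)^ι` as a parameter (any
choice gives the same conclusion). [cite: Weil1964, Chap. III n° 37–38 p. 188–190; MoeglinVignerasWaldspurger1987, Chap. 2 II.2] -/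
theorem exists_omega_eq_adelicTensorEnd_id_left_aux {σ : Type*} [Fintype σ]
    (e : (ι → mixedSpace F) ≃L[ℝ] (σ → ℝ)) (hT : IsUnit T) (p : adelicMpCont F ι T)
    (harch : ∀ a w : ι → mixedSpace F,
      (adelicMpCont.proj F ι T p).1 (archVec F ι a, archVec F ι w) = (archVec F ι a, archVec F ι w)) :
    ∃ B : FinSB F ι →ₗ[ℂ] FinSB F ι, adelicMpCont.omega F ι T p = adelicTensorEnd LinearMap.id B := by
  have hTy : Function.Surjective fun y : ι → AdeleRing (𝓞 F) F => T *ᵥ y := (mulVec_bijective_of_isUnit hT).2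
  have hTa : IsUnit (archMat F ι T) := isUnit_archMat_of_isUnit T hT
  -- the finite implementer and the topological tensor stripping `ω p = A ⊗ M_f`
  obtain ⟨Mf, hMf⟩ := exists_finImplementer hTy (p : adelicMp F ι T)
  have hp : (p : adelicMp F ι T) ∈ adelicMpCont F ι T := p.2
  have hex := exists_continuousLinearEquiv_of_mem_adelicMpCont hTy (p : adelicMp F ι T) hp Mf hMf
  obtain ⟨A, hA, -⟩ := hex
  have hImp : Implements (adelicSchrodinger F ι T)
      (ofSymplectic (polar (adelicForm F ι T)) (adelicMpCont.proj F ι T p))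
      ((p : adelicMp F ι T) : symplecticGroup (polar (adelicForm F ι T)) ×
        (piSchwartzBruhat F ι ≃ₗ[ℂ] piSchwartzBruhat F ι)).2 :=
    (mem_MpPsi _ _).1 (p : adelicMp F ι T).2
  have hAM : ∀ (Φ : 𝓢((ι → mixedSpace F), ℂ)) (f : FinSB F ι),
      ((p : adelicMp F ι T) : symplecticGroup (polar (adelicForm F ι T)) ×
          (piSchwartzBruhat F ι ≃ₗ[ℂ] piSchwartzBruhat F ι)).2 (piSchwartzBruhatEquiv F ι (Φ ⊗ₜ f)) =
        piSchwartzBruhatEquiv F ι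
          ((A : 𝓢((ι → mixedSpace F), ℂ) →ₗ[ℂ] 𝓢((ι → mixedSpace F), ℂ)) Φ ⊗ₜ (Mf : FinSB F ι →ₗ[ℂ] FinSB F ι) f) := by
    intro Φ f
    have h := LinearMap.congr_fun hA (piSchwartzBruhatEquiv F ι (Φ ⊗ₜ f))
    rw [adelicTensorEnd_apply_tmul] at h
    exact h
  -- a finite test vector not killed by `M_f`
  have hf₀ : (Mf : FinSB F ι →ₗ[ℂ] FinSB F ι)
      (indicatorSB F ι (piLevelIdeal F ι ⊤) (isOpen_piLevelIdeal F ⊤) (isCompact_piLevelIdeal F ι ⊤)) ≠ 0 := by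
    intro h
    rw [LinearEquiv.coe_coe] at h
    have h0 : indicatorSB F ι (piLevelIdeal F ι ⊤) (isOpen_piLevelIdeal F ⊤) (isCompact_piLevelIdeal F ι ⊤) = 0 :=
      Mf.injective (by rw [h, map_zero])
    have h1 := congrArg (fun f : FinSB F ι => (f : (ι → FiniteAdeleRing (𝓞 F) F) → ℂ) 0) h0
    simp only [coe_indicatorSB, Set.indicator_of_mem (piLevelIdeal F ι ⊤).zero_mem, ZeroMemClass.coe_zero,
      Pi.zero_apply, one_ne_zero] at h1
  -- `A` commutes with every `ρ_D(p, q)` (trivial phase-space map, cocycle `1`), hence is a scalar (Schur on `𝓢`)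
  have hcomm : ∀ (p' q : σ → ℝ) (Φ : 𝓢((ι → mixedSpace F), ℂ)), A (rhoSD e p' q Φ) = rhoSD e p' q (A Φ) := by
    intro p' q Φ
    have h := comm_rhoSD_of_apply_archVec e hTa (adelicMpCont.proj F ι T p) harch _ hImp
      (A : 𝓢((ι → mixedSpace F), ℂ) →ₗ[ℂ] 𝓢((ι → mixedSpace F), ℂ)) (Mf : FinSB F ι →ₗ[ℂ] FinSB F ι) hAM hf₀ p' q Φ
    simp only [LinearEquiv.coe_coe, ContinuousLinearEquiv.coe_toLinearEquiv] at h
    exact h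
  have hcomm' : ∀ (p' q : σ → ℝ) (Φ : 𝓢((ι → mixedSpace F), ℂ)),
      (A : 𝓢((ι → mixedSpace F), ℂ) →L[ℂ] 𝓢((ι → mixedSpace F), ℂ)) (rhoSD e p' q Φ) =
        rhoSD e p' q ((A : 𝓢((ι → mixedSpace F), ℂ) →L[ℂ] 𝓢((ι → mixedSpace F), ℂ)) Φ) := by
    intro p' q Φ
    rw [ContinuousLinearEquiv.coe_coe]
    exact hcomm p' q Φ
  have hSchur :=
    eq_smul_of_commute_rhoSD e (A : 𝓢((ι → mixedSpace F), ℂ) →L[ℂ] 𝓢((ι → mixedSpace F), ℂ)) hcomm'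
  obtain ⟨c, hc⟩ := hSchur
  -- `ω p = A ⊗ M_f = 1 ⊗ (c • M_f)`
  have hω : adelicMpCont.omega F ι T p =
      (((p : adelicMp F ι T) : symplecticGroup (polar (adelicForm F ι T)) ×
        (piSchwartzBruhat F ι ≃ₗ[ℂ] piSchwartzBruhat F ι)).2 : piSchwartzBruhat F ι →ₗ[ℂ] piSchwartzBruhat F ι) :=
    LinearMap.ext fun _ => rfl
  have key : adelicTensorEnd (A : 𝓢((ι → mixedSpace F), ℂ) →ₗ[ℂ] 𝓢((ι → mixedSpace F), ℂ))
        (Mf : FinSB F ι →ₗ[ℂ] FinSB F ι) =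
      adelicTensorEnd LinearMap.id (c • (Mf : FinSB F ι →ₗ[ℂ] FinSB F ι)) := by
    refine linearMap_ext_tensor fun Φ f => ?_
    rw [adelicTensorEnd_apply_tmul, adelicTensorEnd_apply_tmul, LinearMap.id_apply, LinearMap.smul_apply]
    have hcΦ : (A : 𝓢((ι → mixedSpace F), ℂ) →ₗ[ℂ] 𝓢((ι → mixedSpace F), ℂ)) Φ = c • Φ := by
      have h := hc Φ
      rw [ContinuousLinearEquiv.coe_coe] at h
      simp only [LinearEquiv.coe_coe, ContinuousLinearEquiv.coe_toLinearEquiv]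
      exact h
    rw [hcΦ, TensorProduct.smul_tmul]
  exact ⟨c • (Mf : FinSB F ι →ₗ[ℂ] FinSB F ι), hω.trans (hA.trans key)⟩

/-- **Pairs fixing the archimedean vectors act by `1 ⊗ B`.** Let `T` be invertible and `p ∈ Mp_ψ(W_𝔸)ᶜᵒⁿᵗ` with
`π(p)` fixing every archimedean vector `(archVec a, archVec w)`. Then `ω(p) = 1 ⊗ B` for some linear `B` on
`𝒮((𝔸_F^∞)^ι)`. (Tensor stripping `ω(p) = A ⊗ M_f` with `A` a topological automorphism; `A` commutes with Folland's
`ρ_D(p, q)` for all `(p, q)` since the phase-space map is trivial and the cocycle is `1`; Schur's lemma on `𝓢` makes `A` a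
scalar, absorbed into `M_f`.) [cite: Weil1964, Chap. III n° 37–38 p. 188–190; MoeglinVignerasWaldspurger1987, Chap. 2 II.2] -/
theorem exists_omega_eq_adelicTensorEnd_id_left (hT : IsUnit T) (p : adelicMpCont F ι T)
    (harch : ∀ a w : ι → mixedSpace F,
      (adelicMpCont.proj F ι T p).1 (archVec F ι a, archVec F ι w) = (archVec F ι a, archVec F ι w)) :
    ∃ B : FinSB F ι →ₗ[ℂ] FinSB F ι, adelicMpCont.omega F ι T p = adelicTensorEnd LinearMap.id B :=
  exists_omega_eq_adelicTensorEnd_id_left_aux (mixedSpaceCoord F ι) hT p harch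

/-! #### The finite factor of `ω ∘ s` for `s : H →* Mp_ψ(W_𝔸)ᶜᵒⁿᵗ` fixing the archimedean vectors -/

section FinRepMp

variable {H : Type*} [Monoid H]

/-- **The finite factor `ω_f`** of `h ↦ ω(s h)` for a homomorphism `s : H →* Mp_ψ(W_𝔸)ᶜᵒⁿᵗ` whose symplectic
components fix the archimedean vectors (e.g. the finite level groups `(1_∞, k_f)`), `T` invertible: the representation
`h ↦ finPart (ω (s h))` of `H` on `𝒮((𝔸_F^∞)^ι)`, with `ω (s h) = 1 ⊗ finRepMp s h`.
[cite: Weil1964, Chap. III n° 37–38 p. 188–190; GelbartRogawski1991, §3.1 p. 454] -/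
def finRepMp (hT : IsUnit T) (s : H →* adelicMpCont F ι T)
    (harch : ∀ (h : H) (a w : ι → mixedSpace F),
      (adelicMpCont.proj F ι T (s h)).1 (archVec F ι a, archVec F ι w) = (archVec F ι a, archVec F ι w)) :
    Representation ℂ H (FinSB F ι) :=
  finRep ((adelicMpCont.omega F ι T).comp s) fun h =>
    exists_omega_eq_adelicTensorEnd_id_left hT (s h) (harch h)

variable (hT : IsUnit T) (s : H →* adelicMpCont F ι T)
  (harch : ∀ (h : H) (a w : ι → mixedSpace F),
    (adelicMpCont.proj F ι T (s h)).1 (archVec F ι a, archVec F ι w) = (archVec F ι a, archVec F ι w))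

/-- Unfolding: `finRepMp s h = finPart ω(s h)`. [folklore] -/
@[simp] theorem finRepMp_apply (h : H) : finRepMp hT s harch h = finPart F ι (adelicMpCont.omega F ι T (s h)) :=
  rfl

/-- **`ω (s h) = 1 ⊗ finRepMp s h`.** [cite: Weil1964, Chap. III n° 37–38 p. 188–190] -/
theorem omega_eq_adelicTensorEnd_id_finRepMp (h : H) :
    adelicMpCont.omega F ι T (s h) = adelicTensorEnd LinearMap.id (finRepMp hT s harch h) :=
  eq_adelicTensorEnd_id_finRep ((adelicMpCont.omega F ι T).comp s)
    (fun h => exists_omega_eq_adelicTensorEnd_id_left hT (s h) (harch h)) h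

/-- On pure tensors: `ω (s h) (Φ_∞ ⊗ f) = Φ_∞ ⊗ finRepMp s h f`. [folklore] -/
theorem omega_map_tmul_finRepMp (h : H) (Φ : 𝓢((ι → mixedSpace F), ℂ)) (f : FinSB F ι) :
    adelicMpCont.omega F ι T (s h) (piSchwartzBruhatEquiv F ι (Φ ⊗ₜ f)) =
      piSchwartzBruhatEquiv F ι (Φ ⊗ₜ finRepMp hT s harch h f) :=
  finRep_map_tmul ((adelicMpCont.omega F ι T).comp s)
    (fun h => exists_omega_eq_adelicTensorEnd_id_left hT (s h) (harch h)) h Φ f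

/-- **The test-function identity**: `ω (s h) (Φ_∞ ⊗ 𝟙_{x₀+𝔫𝒪̂}) = Φ_∞ ⊗ finRepMp s h 𝟙_{x₀+𝔫𝒪̂}`. [folklore] -/
theorem omega_thinCosetTestFunₗ_finRepMp (h : H) (x₀ : ι → FiniteAdeleRing (𝓞 F) F) (𝔫 : Ideal (𝓞 F))
    (Φ : 𝓢((ι → mixedSpace F), ℂ)) :
    adelicMpCont.omega F ι T (s h) (thinCosetTestFunₗ (K := F) (ι := ι) x₀ 𝔫 Φ) =
      piSchwartzBruhatEquiv F ι (Φ ⊗ₜ finRepMp hT s harch h (cosetIndicatorSB F ι x₀ 𝔫)) :=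
  finRep_thinCosetTestFunₗ ((adelicMpCont.omega F ι T).comp s)
    (fun h => exists_omega_eq_adelicTensorEnd_id_left hT (s h) (harch h)) h x₀ 𝔫 Φ

/-- **(W-Kf′) criterion**: if `finRepMp s h` fixes `𝟙_{x₀+𝔫𝒪̂}` then `ω (s h)` fixes `Φ_∞ ⊗ 𝟙_{x₀+𝔫𝒪̂}` for EVERY
`Φ_∞`. [folklore] -/
theorem omega_thinCosetTestFunₗ_eq_self (h : H) (x₀ : ι → FiniteAdeleRing (𝓞 F) F) (𝔫 : Ideal (𝓞 F))
    (hfix : finRepMp hT s harch h (cosetIndicatorSB F ι x₀ 𝔫) = cosetIndicatorSB F ι x₀ 𝔫)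
    (Φ : 𝓢((ι → mixedSpace F), ℂ)) :
    adelicMpCont.omega F ι T (s h) (thinCosetTestFunₗ (K := F) (ι := ι) x₀ 𝔫 Φ) =
      thinCosetTestFunₗ (K := F) (ι := ι) x₀ 𝔫 Φ :=
  thinCosetTestFunₗ_eq_self_of_finRep ((adelicMpCont.omega F ι T).comp s)
    (fun h => exists_omega_eq_adelicTensorEnd_id_left hT (s h) (harch h)) h x₀ 𝔫 hfix Φ

/-- **Uniqueness** of the finite factor: an operator `B` with `ω (s h) (Φ₀ ⊗ f) = Φ₀ ⊗ B f` for all `f` and ONE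
`Φ₀ ≠ 0` is `finRepMp s h`. [folklore] -/
theorem finRepMp_unique (h : H) {Φ₀ : 𝓢((ι → mixedSpace F), ℂ)} (hΦ₀ : Φ₀ ≠ 0) {B : FinSB F ι →ₗ[ℂ] FinSB F ι}
    (hB : ∀ f : FinSB F ι, adelicMpCont.omega F ι T (s h) (piSchwartzBruhatEquiv F ι (Φ₀ ⊗ₜ f)) =
      piSchwartzBruhatEquiv F ι (Φ₀ ⊗ₜ B f)) :
    B = finRepMp hT s harch h :=
  finRep_unique ((adelicMpCont.omega F ι T).comp s)
    (fun h => exists_omega_eq_adelicTensorEnd_id_left hT (s h) (harch h)) h hΦ₀ hB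

end FinRepMp

end Mp

end Literature.NumberTheory.Weil1964

end
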